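import Summits.QuantumFields.BalabanUV.T4Continuum.Support.NE3CombGaugeCharge
import Summits.QuantumFields.BalabanUV.T4Continuum.Support.NE3CovariantBlockMean
import Summits.QuantumFields.BalabanUV.T4Continuum.Support.NE3CovariantSliceOrthogonality
import Summits.QuantumFields.BalabanUV.T4Continuum.Support.NE3CoarseTorusExact
import HarnessLib

/-!
# T⁴ programme, node NE3, route H♮ (ρ-g22-2) · row K2 — THE COVARIANT BLOCK POINCARÉ INEQUALITY FOR SECTIONS:
# `Σ_{x∈B(z)} ‖ξ(x) − Φ^W_{bmean_W ξ}(x)‖²_HS ≤ M²·Σ_{x∈B(z)} Σ_μ ‖(D_Wξ)(x,μ)‖²_HS + 4d·(M·(d−1)(M−1)·a)²·Σ_{x∈B(z)} ‖ξ(x)‖²_HS`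
# on ONE block, at every unitary small-field background — LOCAL, no torus, no small divisor

NE3 formalisation swarm `b2b-balaban-t4-ne3-formalise-*`, LEAF PROVER 04 (gen 5), row **K2** of the owner's design ρ-g22-2 (memo
`HOME/t4/b2b-balaban-t4-ne3-p1/g22/D-ne3p1-g22-1.md` §4: «K2 covariant BLOCK Poincaré for sections:
`‖ξ − (bmean_W ξ)∘cdiv‖²_B ≤ C_bP M²‖D_Wξ‖²_B + C(b∕L²)²‖ξ‖²_B` (comb gauge + flat block Poincaré `NE3CoarseTorusExact`∕`NE3BlockPoincareLocal`
tools) SF → leaf-04 lineage»; used in S4 for `‖ζ′ − Φ^W_{bmean ζ′}‖ ≤ C_bP·M·‖D_Wζ′‖ + C_d(b∕L²)‖ζ′‖`).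

OBJECTS (all by name, ONE transport convention — ρ-g22-2a r1): the block `B(z) = {M•z + v : v ∈ periodBox M}` of side `M` (= `L^k` in the
route); the COMB of the block `btree M W z x = W(Γ_{M•z, x})` (row NE3-R2's `AveragingDeficitBlockDensity.btree`, C0's comb gauge
`gaugeAct (btree M W z) W` of `NE3CombGauge`); the TRANSPORTED BLOCK MEAN at scale `M`, `bmeanW M W ξ z = Σ_r M^{−d}•Ad_{W(Γ_{M•z,M•z+r})} ξ(M•z + r)`
(leaf-02-g5's `NE3CovariantBlockMean.bmeanW`, the convention of record, here with block size `M`); the comb-transported corner charge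
`Φ^W_m(x) = Ad_{btree(x)⁻¹} m` (C0 file 2 `NE3CombGaugeCharge`); the covariant derivative of a section = the linearised gauge direction
`gaugeDir W ξ (x,μ) = Ad_{W(x,μ)⁻¹} ξ(x) − ξ(x+e_μ)`; HS currency `nhsNormSq`.

MECHANISM.  In the comb gauge `ξ̃(x) := Ad_{btree(x)} ξ(x)` the covariant derivative is conjugate to that of `ξ̃` at the gauge-fixed
background `W₀ = W^{btree}` (C0 file 2 `gaugeDir_gaugeAct_eq`, exact), `gaugeDir W₀ ξ̃ = −dPot ξ̃ + (Ad_{W₀⁻¹} − 1)ξ̃` (this lineage's Φ5-ORTH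
`gaugeDir_eq_neg_dPot_add_defect`), and `‖W₀(b) − 1‖ ≤ (d−1)(M−1)·a` on the block's bonds (C0 `norm_comb_sub_one_le_single`, B7 pp. 24–25):
so the FLAT differences of `ξ̃` cost `2‖D_Wξ‖² + 8α²‖ξ‖²` per bond (§2), the flat cube Poincaré of this lineage's `NE3CoarseTorusExact`
(constant `M²∕2`, entrywise, §3) bounds `Σ‖ξ̃ − mean ξ̃‖²`, and `ξ̃(x) − mean ξ̃ = Ad_{btree(x)}(ξ(x) − Φ^W_{bmean_W ξ}(x))` isometrically (§4).

CONTENT (all [folklore]; 0 sorry; 0 def):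
§1 `nhsNormSq_Ad_sub_le` (`nhsNormSq (Ad_P X − X) ≤ 4‖P − 1‖²·nhsNormSq X`, unitary `P`), `Ad_inv_Ad`;
§2 **`nhsNormSq_dPot_comb_le`** — on the block (`M•z ≤ x ≤ M•z + (M−1)𝟙`), any `μ`:
   `nhsNormSq (dPot ξ̃ x μ) ≤ 2·nhsNormSq (gaugeDir W ξ x μ) + 8·((d−1)(M−1)a)²·nhsNormSq (ξ x)`;
§3 **`sum_nhsNormSq_sub_bmean_le`** — the flat cube Poincaré in HS currency for matrix-valued site fields (entrywise `NE3CoarseTorusExact`):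
   `Σ_{v∈periodBox M} nhsNormSq (F(q+v) − Σ_r M^{−d}•F(q+r)) ≤ (M²∕2)·Σ_{v}Σ_μ nhsNormSq (F(q+v+e_μ) − F(q+v))`;
§4 **`sum_nhsNormSq_sub_combMean_le`** (K2): for `[Nonempty n]`, `1 ≤ M`, unitary `W`, `0 ≤ a`, `SmallField W a`, any `ξ`, any block `z`:
   `Σ_{v∈periodBox M} nhsNormSq (ξ (M•z+v) − Ad (btree M W z (M•z+v))⁻¹ (bmeanW M W ξ z))
      ≤ M²·Σ_{v∈periodBox M} Σ_μ nhsNormSq (gaugeDir W ξ (M•z+v) μ) + 4d·(M·((d−1)(M−1)a))²·Σ_{v∈periodBox M} nhsNormSq (ξ (M•z+v))`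
   — `C_bP = 1`; the defect constant is `4d(d−1)²·(M(M−1)a)² ≤ 4d³θ²` in the design's currency `θ = M²a ≤ b∕L²`; the bonds used are those
   BASED in the block (one layer of outgoing bonds included, as in `NE3CoarseTorusExact`); NO smallness beyond `0 ≤ a` is needed.

HONEST: one-block covariant kinematics on OUR frame; nothing about Bałaban's minimisers; (P♮)_W, (ML_w) at W ≠ 1, T-E_w, NE3 NOT proved;
spine PROVED 0∕9; finite T⁴ rung (B)+1 — NOT infinite volume, NOT mass gap, NOT BetaPertH, NOT Clay.  PLACEMENT: `Summits/QuantumFields/BalabanUV/`.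
-/

set_option autoImplicit false

open scoped BigOperators Matrix.Norms.L2Operator
open Finset

namespace Summit.QuantumFields.BalabanUV.T4Continuum.NE3CovariantBlockPoincare

open Literature.MathematicalPhysics.QuantumFieldTheory.Balaban1983to89
open B7Prop1Explicit B7Prop2Explicit MatrixNorms
open T4AveragingDeficitWall (IsUnitaryCfg SmallField Ad)
open T4AveragingDeficitWallBoundary (periodBox mem_periodBox)
open T4AveragingDeficitNonAbelian (Ad_mul Ad_sub)
open AveragingDeficitNearIdentity (Ad_one)
open AveragingDeficitTransport (norm_Ad_of_unitary mem_U1_of_unitary)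
open AveragingDeficitHSInner (nhsNormSq_Ad nhsNorm_Ad_sub_le)
open AveragingDeficitBlockDensity (btree)
open BlockAveragePushDirGauge (gaugeDir)
open NE3TangentNoGoWords (dPot)
open NE3CombGauge (norm_comb_sub_one_le_single)
open NE3CombGaugeCharge (gaugeDir_gaugeAct_eq)
open NE3CovariantBlockMean (bmeanW)
open NE3CovariantCalculus (nhsNormSq_sub_le)
open NE3CovariantSliceOrthogonality (gaugeDir_eq_neg_dPot_add_defect)
open NE3CoarseTorusExact (sum_norm_sub_blockMean_sq_le)
open NE3BlockLineAverage (sum_univ_boxVec)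
open SpreadLiftDirection (isUnitaryCfg_gaugeAct')

noncomputable section

variable {d : ℕ} {n : Type*} [Fintype n] [DecidableEq n]

/-! ## §1 Two small transport lemmas -/

/-- `nhsNormSq (Ad_P X − X) ≤ 4·‖P − 1‖²·nhsNormSq X` for unitary `P` (the tree's `nhsNorm_Ad_sub_le`, squared). [folklore] -/
theorem nhsNormSq_Ad_sub_le [Nonempty n] {P : (Matrix n n ℂ)ˣ} (hP : P ∈ unitaryUnits (Matrix n n ℂ)) (X : Matrix n n ℂ) :
    nhsNormSq (Ad P X - X) ≤ 4 * ‖(P : Matrix n n ℂ) - 1‖ ^ 2 * nhsNormSq X := by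
  have h := nhsNorm_Ad_sub_le hP X
  have h0 : 0 ≤ nhsNorm (Ad P X - X) := Real.sqrt_nonneg _
  have h1 := pow_le_pow_left₀ h0 h 2
  rw [nhsNorm_sq] at h1
  calc nhsNormSq (Ad P X - X) ≤ (2 * ‖(P : Matrix n n ℂ) - 1‖ * nhsNorm X) ^ 2 := h1
    _ = 4 * ‖(P : Matrix n n ℂ) - 1‖ ^ 2 * nhsNorm X ^ 2 := by ring
    _ = 4 * ‖(P : Matrix n n ℂ) - 1‖ ^ 2 * nhsNormSq X := by rw [nhsNorm_sq]

/-- `Ad_{u⁻¹} (Ad_u X) = X`. [folklore] -/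
theorem Ad_inv_Ad (u : (Matrix n n ℂ)ˣ) (X : Matrix n n ℂ) : Ad u⁻¹ (Ad u X) = X := by
  rw [← Ad_mul, inv_mul_cancel, Ad_one]

/-! ## §2 Flat differences of the comb-gauge-fixed section against the covariant derivative -/

/-- **ONE BOND IN THE COMB GAUGE**: for unitary `W` with `SmallField W a` (`a ≥ 0`), the gauge-fixed section `ξ̃(y) = Ad_{btree M W z y} ξ(y)`,
a site `x` of the block (`M•z ≤ x ≤ M•z + (M−1)·𝟙`) and any direction `μ`:
`nhsNormSq (dPot ξ̃ x μ) ≤ 2·nhsNormSq (gaugeDir W ξ x μ) + 8·((d−1)(M−1)a)²·nhsNormSq (ξ x)`. [folklore] -/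
theorem nhsNormSq_dPot_comb_le [Nonempty n] {M : ℕ} {W : Site d → Fin d → (Matrix n n ℂ)ˣ} (hWu : IsUnitaryCfg W) {a : ℝ} (ha : 0 ≤ a)
    (hWa : SmallField W a) (ξ : Site d → Matrix n n ℂ) (z : Site d) {x : Site d} (hx : (M : ℤ) • z ≤ x)
    (hx' : x ≤ (M : ℤ) • z + fun _ => (M : ℤ) - 1) (μ : Fin d) :
    nhsNormSq (dPot (fun y => Ad (btree M W z y) (ξ y)) x μ)
      ≤ 2 * nhsNormSq (gaugeDir W ξ x μ) + 8 * (((d : ℝ) - 1) * ((M : ℝ) - 1) * a) ^ 2 * nhsNormSq (ξ x) := by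
  letI : CStarAlgebra (Matrix n n ℂ) := {}
  set u : Site d → (Matrix n n ℂ)ˣ := btree M W z with hu
  set ξt : Site d → Matrix n n ℂ := fun y => Ad (u y) (ξ y) with hξt
  have huu : ∀ y, u y ∈ unitaryUnits (Matrix n n ℂ) := fun y => hol_mem_of hWu _ _
  have hg : gaugeAct u W x μ ∈ unitaryUnits (Matrix n n ℂ) := isUnitaryCfg_gaugeAct' huu hWu x μ
  have hgi : (gaugeAct u W x μ)⁻¹ ∈ unitaryUnits (Matrix n n ℂ) := (unitaryUnits _).inv_mem hg
  -- the gauge-fixed covariant derivative is the transported one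
  have hback : (fun y => Ad (u y)⁻¹ (ξt y)) = ξ := by funext y; simp only [hξt]; exact Ad_inv_Ad _ _
  have hcov : gaugeDir (gaugeAct u W) ξt x μ = Ad (u (x + e μ)) (gaugeDir W ξ x μ) := by
    rw [gaugeDir_gaugeAct_eq, hback]
  -- `dPot ξ̃ = defect − gaugeDir W₀ ξ̃`
  have hsplit : dPot ξt x μ = (Ad (gaugeAct u W x μ)⁻¹ (ξt x) - ξt x) - Ad (u (x + e μ)) (gaugeDir W ξ x μ) := by
    have h := gaugeDir_eq_neg_dPot_add_defect (gaugeAct u W) ξt x μ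
    rw [hcov] at h
    rw [h]; abel
  -- the defect
  have hα : ‖((gaugeAct u W x μ : (Matrix n n ℂ)ˣ) : Matrix n n ℂ) - 1‖ ≤ ((d : ℝ) - 1) * ((M : ℝ) - 1) * a :=
    norm_comb_sub_one_le_single hWu hWa ha z hx hx' μ
  have hαi : ‖(((gaugeAct u W x μ)⁻¹ : (Matrix n n ℂ)ˣ) : Matrix n n ℂ) - 1‖ ≤ ((d : ℝ) - 1) * ((M : ℝ) - 1) * a :=
    (norm_inv_sub_one_le (mem_U1_of_unitary hg)).trans hα
  have hα0 : 0 ≤ ((d : ℝ) - 1) * ((M : ℝ) - 1) * a := (norm_nonneg _).trans hα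
  have hdef : nhsNormSq (Ad (gaugeAct u W x μ)⁻¹ (ξt x) - ξt x) ≤ 4 * (((d : ℝ) - 1) * ((M : ℝ) - 1) * a) ^ 2 * nhsNormSq (ξ x) := by
    have h1 := nhsNormSq_Ad_sub_le hgi (ξt x)
    have h2 : nhsNormSq (ξt x) = nhsNormSq (ξ x) := by simp only [hξt]; exact nhsNormSq_Ad (huu x) _
    rw [h2] at h1
    refine h1.trans (mul_le_mul_of_nonneg_right ?_ (nhsNormSq_nonneg _))
    exact mul_le_mul_of_nonneg_left (pow_le_pow_left₀ (norm_nonneg _) hαi 2) (by norm_num)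
  have hcv : nhsNormSq (Ad (u (x + e μ)) (gaugeDir W ξ x μ)) = nhsNormSq (gaugeDir W ξ x μ) := nhsNormSq_Ad (huu _) _
  rw [hsplit]
  have h := nhsNormSq_sub_le (Ad (gaugeAct u W x μ)⁻¹ (ξt x) - ξt x) (Ad (u (x + e μ)) (gaugeDir W ξ x μ))
  rw [hcv] at h
  linarith

/-! ## §3 The flat cube Poincaré in Hilbert–Schmidt currency -/

omit [DecidableEq n] in
/-- Reordering a four-fold sum (entries inside ↔ outside). [folklore] -/
theorem sum4_comm (P : Finset (Site d)) (t : Site d → Fin d → n → n → ℝ) :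
    ∑ i, ∑ j, ∑ v ∈ P, ∑ μ : Fin d, t v μ i j = ∑ v ∈ P, ∑ μ : Fin d, ∑ i, ∑ j, t v μ i j := by
  calc ∑ i, ∑ j, ∑ v ∈ P, ∑ μ : Fin d, t v μ i j
      = ∑ i, ∑ v ∈ P, ∑ j, ∑ μ : Fin d, t v μ i j := Finset.sum_congr rfl fun i _ => Finset.sum_comm
    _ = ∑ v ∈ P, ∑ i, ∑ j, ∑ μ : Fin d, t v μ i j := Finset.sum_comm
    _ = ∑ v ∈ P, ∑ i, ∑ μ : Fin d, ∑ j, t v μ i j :=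
        Finset.sum_congr rfl fun v _ => Finset.sum_congr rfl fun i _ => Finset.sum_comm
    _ = ∑ v ∈ P, ∑ μ : Fin d, ∑ i, ∑ j, t v μ i j := Finset.sum_congr rfl fun v _ => Finset.sum_comm

omit [DecidableEq n] in
/-- **FLAT BLOCK POINCARÉ FOR MATRIX-VALUED SITE FIELDS (HS)**: `M ≥ 1`, `q` a corner:
`Σ_{v∈periodBox M} nhsNormSq (F(q+v) − Σ_r M^{−d}•F(q+r)) ≤ (M²∕2)·Σ_{v∈periodBox M} Σ_μ nhsNormSq (F(q+v+e_μ) − F(q+v))` — entrywise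
`NE3CoarseTorusExact.sum_norm_sub_blockMean_sq_le`. [folklore] -/
theorem sum_nhsNormSq_sub_bmean_le [Nonempty n] {M : ℕ} (hM : 1 ≤ M) (F : Site d → Matrix n n ℂ) (q : Site d) :
    ∑ v ∈ periodBox (d := d) M, nhsNormSq (F (q + v) - ∑ r : Fin d → Fin M, (((M : ℝ) ^ d)⁻¹ : ℝ) • F (q + boxVec M r))
      ≤ (M : ℝ) ^ 2 / 2 * ∑ v ∈ periodBox (d := d) M, ∑ μ : Fin d, nhsNormSq (F (q + v + e μ) - F (q + v)) := by
  have hc : (0 : ℝ) < Fintype.card n := by exact_mod_cast Fintype.card_pos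
  -- each entry: the ℂ-valued cube Poincaré
  have hentry : ∀ (i j : n), ∑ v ∈ periodBox (d := d) M,
      ‖(F (q + v) - ∑ r : Fin d → Fin M, (((M : ℝ) ^ d)⁻¹ : ℝ) • F (q + boxVec M r)) i j‖ ^ 2
        ≤ (M : ℝ) ^ 2 / 2 * ∑ v ∈ periodBox (d := d) M, ∑ μ : Fin d, ‖F (q + v + e μ) i j - F (q + v) i j‖ ^ 2 := by
    intro i j
    have h := sum_norm_sub_blockMean_sq_le hM (fun x => F x i j) q
    have hmean : ∀ v : Site d, (F (q + v) - ∑ r : Fin d → Fin M, (((M : ℝ) ^ d)⁻¹ : ℝ) • F (q + boxVec M r)) i j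
        = F (q + v) i j - (∑ w ∈ periodBox (d := d) M, F (q + w) i j) / ((M : ℂ) ^ d) := by
      intro v
      rw [Matrix.sub_apply, Matrix.sum_apply]
      congr 1
      rw [← sum_univ_boxVec M (fun w => F (q + w) i j), Finset.sum_div]
      refine Finset.sum_congr rfl fun r _ => ?_
      rw [Matrix.smul_apply, Complex.real_smul, div_eq_inv_mul]
      congr 1
      rw [Complex.ofReal_inv, Complex.ofReal_pow, Complex.ofReal_natCast]
    simp_rw [hmean]
    exact h
  -- multiply by `card n` and sum the entries
  have key : (Fintype.card n : ℝ) * ∑ v ∈ periodBox (d := d) M,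
        nhsNormSq (F (q + v) - ∑ r : Fin d → Fin M, (((M : ℝ) ^ d)⁻¹ : ℝ) • F (q + boxVec M r))
      ≤ (Fintype.card n : ℝ) * ((M : ℝ) ^ 2 / 2 * ∑ v ∈ periodBox (d := d) M, ∑ μ : Fin d, nhsNormSq (F (q + v + e μ) - F (q + v))) := by
    have hL : (Fintype.card n : ℝ) * ∑ v ∈ periodBox (d := d) M,
          nhsNormSq (F (q + v) - ∑ r : Fin d → Fin M, (((M : ℝ) ^ d)⁻¹ : ℝ) • F (q + boxVec M r))
        = ∑ i, ∑ j, ∑ v ∈ periodBox (d := d) M,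
            ‖(F (q + v) - ∑ r : Fin d → Fin M, (((M : ℝ) ^ d)⁻¹ : ℝ) • F (q + boxVec M r)) i j‖ ^ 2 := by
      rw [Finset.mul_sum]
      calc ∑ v ∈ periodBox (d := d) M, (Fintype.card n : ℝ)
              * nhsNormSq (F (q + v) - ∑ r : Fin d → Fin M, (((M : ℝ) ^ d)⁻¹ : ℝ) • F (q + boxVec M r))
          = ∑ v ∈ periodBox (d := d) M, ∑ i, ∑ j,
              ‖(F (q + v) - ∑ r : Fin d → Fin M, (((M : ℝ) ^ d)⁻¹ : ℝ) • F (q + boxVec M r)) i j‖ ^ 2 :=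
            Finset.sum_congr rfl fun v _ => card_mul_nhsNormSq _
        _ = ∑ i, ∑ v ∈ periodBox (d := d) M, ∑ j,
              ‖(F (q + v) - ∑ r : Fin d → Fin M, (((M : ℝ) ^ d)⁻¹ : ℝ) • F (q + boxVec M r)) i j‖ ^ 2 := Finset.sum_comm
        _ = _ := Finset.sum_congr rfl fun i _ => Finset.sum_comm
    have hR : (Fintype.card n : ℝ) * ((M : ℝ) ^ 2 / 2 * ∑ v ∈ periodBox (d := d) M, ∑ μ : Fin d, nhsNormSq (F (q + v + e μ) - F (q + v)))
        = (M : ℝ) ^ 2 / 2 * ∑ v ∈ periodBox (d := d) M, ∑ μ : Fin d, ∑ i, ∑ j, ‖F (q + v + e μ) i j - F (q + v) i j‖ ^ 2 := by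
      rw [mul_left_comm]
      congr 1
      rw [Finset.mul_sum]
      refine Finset.sum_congr rfl fun v _ => ?_
      rw [Finset.mul_sum]
      refine Finset.sum_congr rfl fun μ _ => ?_
      rw [card_mul_nhsNormSq]
      simp only [Matrix.sub_apply]
    rw [hL, hR, ← sum4_comm (periodBox (d := d) M) (fun v μ i j => ‖F (q + v + e μ) i j - F (q + v) i j‖ ^ 2),
      Finset.mul_sum]
    refine Finset.sum_le_sum fun i _ => ?_
    rw [Finset.mul_sum]
    exact Finset.sum_le_sum fun j _ => hentry i j
  exact le_of_mul_le_mul_left key hc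

/-! ## §4 K2: the covariant block Poincaré inequality for sections -/

/-- **THE COVARIANT BLOCK POINCARÉ INEQUALITY FOR SECTIONS (K2)**: `[Nonempty n]`, `1 ≤ M`, unitary `W`, `0 ≤ a`, `SmallField W a`,
any section `ξ`, any block `z` (corner `M•z`):
`Σ_{v∈periodBox M} nhsNormSq (ξ (M•z+v) − Ad (btree M W z (M•z+v))⁻¹ (bmeanW M W ξ z))
 ≤ M²·Σ_{v∈periodBox M} Σ_μ nhsNormSq (gaugeDir W ξ (M•z+v) μ) + 4d·(M·((d−1)(M−1)a))²·Σ_{v∈periodBox M} nhsNormSq (ξ (M•z+v))`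
— the section minus its comb-transported transported-block-mean, against its covariant derivative on the block's bonds plus a
curvature defect `O((M²a)²)`; LOCAL (one block), k-free, N-free, no small divisor. [folklore] -/
theorem sum_nhsNormSq_sub_combMean_le [Nonempty n] {M : ℕ} (hM : 1 ≤ M) {W : Site d → Fin d → (Matrix n n ℂ)ˣ} (hWu : IsUnitaryCfg W)
    {a : ℝ} (ha : 0 ≤ a) (hWa : SmallField W a) (ξ : Site d → Matrix n n ℂ) (z : Site d) :
    ∑ v ∈ periodBox (d := d) M, nhsNormSq (ξ ((M : ℤ) • z + v) - Ad (btree M W z ((M : ℤ) • z + v))⁻¹ (bmeanW M W ξ z))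
      ≤ (M : ℝ) ^ 2 * ∑ v ∈ periodBox (d := d) M, ∑ μ : Fin d, nhsNormSq (gaugeDir W ξ ((M : ℤ) • z + v) μ)
        + 4 * d * ((M : ℝ) * (((d : ℝ) - 1) * ((M : ℝ) - 1) * a)) ^ 2 * ∑ v ∈ periodBox (d := d) M, nhsNormSq (ξ ((M : ℤ) • z + v)) := by
  letI : CStarAlgebra (Matrix n n ℂ) := {}
  set q : Site d := (M : ℤ) • z with hq
  set u : Site d → (Matrix n n ℂ)ˣ := btree M W z with hu
  set ξt : Site d → Matrix n n ℂ := fun y => Ad (u y) (ξ y) with hξt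
  have huu : ∀ y, u y ∈ unitaryUnits (Matrix n n ℂ) := fun y => hol_mem_of hWu _ _
  -- (a) the comb-transported mean IS the flat mean of the gauge-fixed section
  have hmean : bmeanW M W ξ z = ∑ r : Fin d → Fin M, (((M : ℝ) ^ d)⁻¹ : ℝ) • ξt (q + boxVec M r) := by
    simp only [bmeanW, hξt, hu, btree, hq, add_sub_cancel_left]
  -- (b) pointwise: `ξ̃ x − mean = Ad_{u x}(ξ x − Ad_{(u x)⁻¹} mean)`, an HS isometry
  have hiso : ∀ v : Site d, nhsNormSq (ξ (q + v) - Ad (u (q + v))⁻¹ (bmeanW M W ξ z))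
      = nhsNormSq (ξt (q + v) - ∑ r : Fin d → Fin M, (((M : ℝ) ^ d)⁻¹ : ℝ) • ξt (q + boxVec M r)) := by
    intro v
    rw [← hmean, ← nhsNormSq_Ad (huu (q + v)) (ξ (q + v) - Ad (u (q + v))⁻¹ (bmeanW M W ξ z)), Ad_sub]
    simp only [hξt]
    rw [NE3GaugeDirFrames.Ad_Ad_inv]
  -- (c) flat cube Poincaré for `ξ̃`, then (d) the bondwise comparison
  have hflat := sum_nhsNormSq_sub_bmean_le (n := n) hM ξt q
  have hbond : ∀ v ∈ periodBox (d := d) M, ∀ μ : Fin d, nhsNormSq (ξt (q + v + e μ) - ξt (q + v))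
      ≤ 2 * nhsNormSq (gaugeDir W ξ (q + v) μ) + 8 * (((d : ℝ) - 1) * ((M : ℝ) - 1) * a) ^ 2 * nhsNormSq (ξ (q + v)) := by
    intro v hv μ
    have hb := mem_periodBox.mp hv
    have hx : (M : ℤ) • z ≤ q + v := by
      rw [hq]; intro i; simp only [Pi.add_apply]; linarith [(hb i).1]
    have hx' : q + v ≤ (M : ℤ) • z + fun _ => (M : ℤ) - 1 := by
      rw [hq]; intro i; simp only [Pi.add_apply]; linarith [(hb i).2]
    have h := nhsNormSq_dPot_comb_le (M := M) hWu ha hWa ξ z hx hx' μ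
    simpa only [dPot, hξt, hu] using h
  have hM0 : (0 : ℝ) ≤ (M : ℝ) ^ 2 / 2 := by positivity
  calc ∑ v ∈ periodBox (d := d) M, nhsNormSq (ξ (q + v) - Ad (u (q + v))⁻¹ (bmeanW M W ξ z))
      = ∑ v ∈ periodBox (d := d) M, nhsNormSq (ξt (q + v) - ∑ r : Fin d → Fin M, (((M : ℝ) ^ d)⁻¹ : ℝ) • ξt (q + boxVec M r)) :=
        Finset.sum_congr rfl fun v _ => hiso v
    _ ≤ (M : ℝ) ^ 2 / 2 * ∑ v ∈ periodBox (d := d) M, ∑ μ : Fin d, nhsNormSq (ξt (q + v + e μ) - ξt (q + v)) := hflat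
    _ ≤ (M : ℝ) ^ 2 / 2 * ∑ v ∈ periodBox (d := d) M, ∑ μ : Fin d,
          (2 * nhsNormSq (gaugeDir W ξ (q + v) μ) + 8 * (((d : ℝ) - 1) * ((M : ℝ) - 1) * a) ^ 2 * nhsNormSq (ξ (q + v))) :=
        mul_le_mul_of_nonneg_left (Finset.sum_le_sum fun v hv => Finset.sum_le_sum fun μ _ => hbond v hv μ) hM0
    _ = (M : ℝ) ^ 2 * ∑ v ∈ periodBox (d := d) M, ∑ μ : Fin d, nhsNormSq (gaugeDir W ξ (q + v) μ)
        + 4 * d * ((M : ℝ) * (((d : ℝ) - 1) * ((M : ℝ) - 1) * a)) ^ 2 * ∑ v ∈ periodBox (d := d) M, nhsNormSq (ξ (q + v)) := by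
        simp only [Finset.sum_add_distrib, Finset.sum_const, Finset.card_univ, Fintype.card_fin, nsmul_eq_mul, Finset.mul_sum,
          mul_add]
        congr 1
        · exact Finset.sum_congr rfl fun v _ => (Finset.sum_congr rfl fun μ _ => by ring)
        · exact Finset.sum_congr rfl fun v _ => by ring

end

end Summit.QuantumFields.BalabanUV.T4Continuum.NE3CovariantBlockPoincare
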